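import Summits.BirchSwinnertonDyer.BirchSwinnertonDyer.Theses.UniversalToricDescent
import Summits.BirchSwinnertonDyer.BirchSwinnertonDyer.Theorems.UniversalToricDescentTwinSplitIMCAtThreeOfThreeFrames
import Summits.BirchSwinnertonDyer.BirchSwinnertonDyer.Theorems.UniversalToricDescentSelfMuZeroAtThree
import HarnessLib

/-!
# SKELETON `threeframes-apzero` (line `threeframes`, lead bsd-wall-utd-p2 g10, 2026-08-28) for the LIVE crux
# `TwinSplitIMCAtThreeGoodSSApZero` (stmt-BirchSwinnertonDyer-23594) — the `a₃ = 0` half C₀ of the retired bucket-C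
# crux 20695 (route `UniversalToricDescent` rev ≥ 22; text = 20695 verbatim + `W'.frobeniusTrace 3 = 0 →`).

Same stub set and composition as g8/g9's registration (skeleton sha db30f8f3a60a…, evidence #10 on 23594; re-typed here
because earlier leads' folders are not mounted): the two `∃`-frame research stubs of v4 (`Cruxes/TwinSplitIMCAtThreeGoodSS/
Lines/threeframes.lean`) restricted to `a₃ = 0`, plus the by-name refereed fact stub; `TwinSplitIMCAtThreeGoodSSApZero_of`
concludes the crux BY NAME through the landed lattice theorem `twinSplit_instance_of_three_frames` (p543791).
* `stub_howardFrameSS_apZero` — ONE BDP frame inside `Ch_Λ(X_{∅,0})·R₀⟦T⟧` (the `⊇` = Kolyvagin direction): PORT of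
  Castella–Wan 2024 Thm 5.12 + §6.1 (first half) to `p = 3`, `a_p = 0`. Inputs already in the tree: 3-adic image over `K`
  (p595026/p596097), irreducibility over `K`, `E(K_∞)[3] = 0`, Sah/H.2 at `3`, analytic frame by name; NOT in the tree: the
  `±` Λ-adic Heegner classes / `±` Coleman maps / `±` explicit reciprocity law, Howard's Λ-adic Kolyvagin-system machine. XL port.
* `stub_wanFrameSS_apZero` — the rational Wan frame (`3^k · Ch ⊆ (L)`, the `⊆` = Eisenstein direction) at a good-ss `3` under the
  CLASSICAL Heegner hypothesis: NOT IN PRINT at `p = 3` (BBL-II / Kobayashi–Ota need `p ≥ 5`; CW24 Thm 5.3 / CLW22 need a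
  NON-split prime of `N′`). Research.
* `stub_thmB` — Hsieh 2014 Thm. B (any level), BY NAME.
BSD is not proved by any of this.
-/

noncomputable section

open scoped Classical

set_option linter.dupNamespace false
set_option autoImplicit false

namespace Summit.BirchSwinnertonDyer.BirchSwinnertonDyer.Cruxes.TwinSplitIMCAtThreeGoodSSApZero.ThreeFrames

open PowerSeries WeierstrassCurve NumberField IsDedekindDomain Field
  Literature.NumberTheory.EllipticCurves
  Literature.NumberTheory.EllipticCurves.ModularForms
  Literature.NumberTheory.EllipticCurves.Rank1Residual
  Summit.BirchSwinnertonDyer.Rank1Residual.X11b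
  Summit.BirchSwinnertonDyer.Rank1Residual.X11b.Halves
  Summit.BirchSwinnertonDyer.BirchSwinnertonDyer.Theorems.SchneiderFree
  Summit.BirchSwinnertonDyer.BirchSwinnertonDyer.Theorems.UniversalToricDescentTwinSplit

/-- STUB (Howard frame at a good-supersingular twin with `a₃ = 0`: ONE BDP frame inside `Ch_Λ(X_{∅,0})·R₀⟦T⟧`;
= PORT of Castella–Wan 2024 Thm 5.12 + §6.1 first half to `p = 3`, `a_p = 0`). -/
theorem stub_howardFrameSS_apZero :
    ∀ (W' : WeierstrassCurve ℚ) [W'.IsElliptic] [W'.IsGloballyMinimal] (N' : ℕ) [NeZero N']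
      (K : Type) [Field K] [NumberField K] (Dt' : ModularParametrizationData W' N'),
      GoodSS W' 3 → W'.frobeniusTrace 3 = 0 → W'.HasSurjectiveModNGaloisRep 3 → W'.conductorNorm ℤ = N' → IsImaginaryQuadratic K →
      SatisfiesHeegnerHypothesis N' K → Odd (NumberField.discr K) →
      ∀ (κ : ZpExtension K 3), κ.IsAnticyclotomic → ∀ (γ : absoluteGaloisGroup K) [Fact (κ.IsTopGenerator γ)]
        (𝔭 : HeightOneSpectrum (𝓞 K)), ((3 : ℕ) : 𝓞 K) ∈ 𝔭.asIdeal →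
        𝔭.asIdeal.ramificationIdx (𝓞 ℚ) = 1 → 𝔭.asIdeal.inertiaDeg (𝓞 ℚ) = 1 →
        ∀ (𝔭' : HeightOneSpectrum (𝓞 K)), ((3 : ℕ) : 𝓞 K) ∈ 𝔭'.asIdeal → 𝔭' ≠ 𝔭 →
        ∀ (ι' : PadicAlgCl 3 ≃+* ℂ), BranchInducesPrime 3 ι' 𝔭 →
        ∃ (ΩK : ℂ) (Ωp : ℂ_[3]) (L : UnrSeries 3), ΩK ≠ 0 ∧ Ωp ≠ 0 ∧
          IsBDPLFunction ι' 𝔭 κ γ Dt'.f ΩK Ωp L ∧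
          L ∈ (AcSelmer.XAc.charIdeal (W'.baseChange K) 3 κ 𝔭' ∅ γ).map (PowerSeries.map (toUnr 3)) := by
  sorry

/-- STUB (rational Wan frame at a good-supersingular twin with `a₃ = 0` under the CLASSICAL Heegner hypothesis:
`∃ k, 3^k · Ch_Λ(X_{∅,0})·R₀⟦T⟧ ⊆ (L)`; NOT in print at `p = 3`). -/
theorem stub_wanFrameSS_apZero :
    ∀ (W' : WeierstrassCurve ℚ) [W'.IsElliptic] [W'.IsGloballyMinimal] (N' : ℕ) [NeZero N']
      (K : Type) [Field K] [NumberField K] (Dt' : ModularParametrizationData W' N'),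
      GoodSS W' 3 → W'.frobeniusTrace 3 = 0 → W'.HasSurjectiveModNGaloisRep 3 → W'.conductorNorm ℤ = N' → IsImaginaryQuadratic K →
      SatisfiesHeegnerHypothesis N' K → Odd (NumberField.discr K) →
      ∀ (κ : ZpExtension K 3), κ.IsAnticyclotomic → ∀ (γ : absoluteGaloisGroup K) [Fact (κ.IsTopGenerator γ)]
        (𝔭 : HeightOneSpectrum (𝓞 K)), ((3 : ℕ) : 𝓞 K) ∈ 𝔭.asIdeal →
        𝔭.asIdeal.ramificationIdx (𝓞 ℚ) = 1 → 𝔭.asIdeal.inertiaDeg (𝓞 ℚ) = 1 →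
        ∀ (𝔭' : HeightOneSpectrum (𝓞 K)), ((3 : ℕ) : 𝓞 K) ∈ 𝔭'.asIdeal → 𝔭' ≠ 𝔭 →
        ∀ (ι' : PadicAlgCl 3 ≃+* ℂ), BranchInducesPrime 3 ι' 𝔭 →
        ∃ (ΩK : ℂ) (Ωp : ℂ_[3]) (L : UnrSeries 3), ΩK ≠ 0 ∧ Ωp ≠ 0 ∧
          IsBDPLFunction ι' 𝔭 κ γ Dt'.f ΩK Ωp L ∧
          ∃ k : ℕ, ∀ G ∈ (AcSelmer.XAc.charIdeal (W'.baseChange K) 3 κ 𝔭' ∅ γ).map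
            (PowerSeries.map (toUnr 3)), PowerSeries.C (((3 : ℕ) : unrIntegers 3) ^ k) * G ∈ Ideal.span {L} := by
  sorry

/-- STUB (BY-NAME, refereed; closes only by formalisation): Hsieh 2014 Thm. B at every level.
[cite: Hsieh2014, Thm. B p. 712 (Doc. Math. 19)] -/
theorem stub_thmB : Hsieh2014.thmB_exists_isHsiehLFunction_coeff_norm_eq_one_unrPeriod_anyLevel := by
  sorry

/-- DERIVED (no sorry of its own): every `R₀`-frame of `f_W` has a UNIT coefficient, from `stub_thmB`
(= landed `Theorems.exists_isUnit_coeff_of_isBDPLFunction_of_thmB`, p569658; utd-p1 g4's ♭-witness moved across periods).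
[cite: Hsieh2014, Thm. B p. 712 (Doc. Math. 19)] -/
theorem exists_isUnit_coeff_of_frame
    (W : WeierstrassCurve ℚ) [W.IsElliptic] (N : ℕ) [NeZero N]
    (K : Type) [Field K] [NumberField K] (Dt : ModularParametrizationData W N)
    (honto : W.HasSurjectiveModNGaloisRep 3) (hK : IsImaginaryQuadratic K)
    (hH : SatisfiesHeegnerHypothesis N K) (κ : ZpExtension K 3) (hκ : κ.IsAnticyclotomic)
    (γ : absoluteGaloisGroup K) [Fact (κ.IsTopGenerator γ)]
    (𝔭 : HeightOneSpectrum (𝓞 K)) (h𝔭 : ((3 : ℕ) : 𝓞 K) ∈ 𝔭.asIdeal)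
    (he : 𝔭.asIdeal.ramificationIdx (𝓞 ℚ) = 1) (hf : 𝔭.asIdeal.inertiaDeg (𝓞 ℚ) = 1)
    (ι' : PadicAlgCl 3 ≃+* ℂ) (hι' : BranchInducesPrime 3 ι' 𝔭)
    {ΩK : ℂ} {Ωp : ℂ_[3]} {L : UnrSeries 3} (hΩK : ΩK ≠ 0) (hΩp : Ωp ≠ 0)
    (hL : IsBDPLFunction ι' 𝔭 κ γ Dt.f ΩK Ωp L) :
    ∃ i : ℕ, IsUnit (PowerSeries.coeff i L) := by
  obtain ⟨ΩK₁, Ωp₁, Q, hΩK₁, hΩp₁, hQ, hμQ⟩ :=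
    Summit.BirchSwinnertonDyer.BirchSwinnertonDyer.Theorems.UniversalToricDescentSelfMuZero.self_exists_isBDPLFunctionInt_coeff_norm_eq_one stub_thmB W N K Dt honto hK hH
      κ hκ γ 𝔭 h𝔭 he hf ι' hι'
  have hΩp₁0 : Ωp₁ ≠ 0 := fun h ↦ by rw [h, norm_zero] at hΩp₁; exact zero_ne_one hΩp₁
  obtain ⟨i, hi⟩ :=
    Summit.BirchSwinnertonDyer.BirchSwinnertonDyer.Theorems.UniversalToricDescentFlatMuTransfer.exists_coeff_norm_eq_one_of_isBDPLFunctionInt_of_isBDPLFunction hK hκ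
      Fact.out hΩK₁ hΩK hΩp₁0 hΩp hQ hL hμQ
  exact ⟨i, (unrIntegers.isUnit_iff_norm_eq_one _).mpr hi⟩

/-- COMPOSITION: the two frame stubs and the by-name fact give the crux `TwinSplitIMCAtThreeGoodSSApZero` BY NAME
(`twinSplit_instance_of_three_frames`, p543791; the `μ`-frame is the Howard frame, unit coefficient by
`exists_isUnit_coeff_of_frame`). -/
theorem TwinSplitIMCAtThreeGoodSSApZero_of :
    Summit.BirchSwinnertonDyer.BirchSwinnertonDyer.Theses.UniversalToricDescent.TwinSplitIMCAtThreeGoodSSApZero := by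
  intro W' _ _ N' _ K _ _ Dt' hss ha hsurj hN' hK hH hodd κ hκ γ _ 𝔭 h𝔭 he hf 𝔭' h𝔭' hne ι' hι'
  have hH1 := stub_howardFrameSS_apZero W' N' K Dt' hss ha hsurj hN' hK hH hodd κ hκ γ 𝔭 h𝔭 he hf 𝔭' h𝔭' hne ι' hι'
  have hMu : ∃ (ΩK : ℂ) (Ωp : ℂ_[3]) (L : UnrSeries 3), ΩK ≠ 0 ∧ Ωp ≠ 0 ∧
      IsBDPLFunction ι' 𝔭 κ γ Dt'.f ΩK Ωp L ∧ ∃ i : ℕ, IsUnit (PowerSeries.coeff i L) := by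
    obtain ⟨ΩK, Ωp, L, hΩK, hΩp, hL, -⟩ := hH1
    exact ⟨ΩK, Ωp, L, hΩK, hΩp, hL, exists_isUnit_coeff_of_frame W' N' K Dt' hsurj hK hH κ hκ γ 𝔭 h𝔭 he hf ι' hι'
      hΩK hΩp hL⟩
  exact twinSplit_instance_of_three_frames W' N' K Dt' κ γ 𝔭 𝔭' ι' hK hκ hH1
    (stub_wanFrameSS_apZero W' N' K Dt' hss ha hsurj hN' hK hH hodd κ hκ γ 𝔭 h𝔭 he hf 𝔭' h𝔭' hne ι' hι') hMu

end Summit.BirchSwinnertonDyer.BirchSwinnertonDyer.Cruxes.TwinSplitIMCAtThreeGoodSSApZero.ThreeFrames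

end
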